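import Mathlib
import Summits.MatrixMultiplication.Statement
import Summits.MatrixMultiplication.MatrixMultiplication.Theorems.GraphEquationsExactStep
import Summits.MatrixMultiplication.MatrixMultiplication.Theorems.GraphEquationsKernelSection

/-!
# Graph equations — the engine's FIELD hypotheses come from kernel sections (M19l)

The level-1 engine `tensorRank_le_of_sqMembers_affine` (M19k) asks for ONE affine field `ξ` whose
deflated tests `D_ξ t_o` have no constant and no `(a,b)`-linear term (V0/V1).  This module discharges
that from the tree's kernel sections (`kernelSectionAtMaxRank`, GraphEquationsKernelSection):

* `coeff_mul_eq_zero_of_degree_le_one` — if `f` has no terms of degree `≤ 1` then neither has `f·g`;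
* `section01_of_kernelSection` — an exact polynomial kernel section `η` of the row matrix `R` through
  `c·γ` (`c ≠ 0`) truncates to an affine field `ξ = γ + λ·x` with `Σ_q ξ_q R_oq` free of terms of degree
  `≤ 1` (an ORDER-1 SECTION) — the companion of `jet_of_kernelSection` (degree 2, LIFT);
* `coeff_zero_derivC_eq`, `coeff_single_inl_derivC_eq` — V0/V1 of `D_ξ t` are the degree-`≤ 1`
  coefficients of `Σ_q ξ_q r_q(t)` (`graphRestrict_derivC`);
* `derivC_V01_of_section01` — an order-1 section gives V0/V1 for every deflated test;
* `exists_affField_V01` — at a base of maximal row rank, EVERY kernel vector `γ` of the `c`-Jacobian is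
  the value of a cost-free affine field with V0/V1 (no LIFT / `M` needed by the exact-members engine).
-/

set_option linter.dupNamespace false

noncomputable section

open scoped BigOperators

namespace Summit.MatrixMultiplication.MatrixMultiplication.Theorems.GraphEquations

open MvPolynomial
open Literature.Computability.AlgebraicComplexity
open Literature.Computability.AlgebraicComplexity.ArithCircuit

variable {n : ℕ}

section orders

variable {σ R : Type*} [CommSemiring R]

/-- If `f` has no terms of degree `≤ 1`, then `f·g` has no terms of degree `≤ 1`. -/
theorem coeff_mul_eq_zero_of_degree_le_one {f : MvPolynomial σ R}
    (hf : ∀ m : σ →₀ ℕ, m.degree ≤ 1 → coeff m f = 0) (g : MvPolynomial σ R)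
    {m : σ →₀ ℕ} (hm : m.degree ≤ 1) : coeff m (f * g) = 0 := by
  classical
  rw [coeff_mul]
  refine Finset.sum_eq_zero fun x hx => ?_
  replace hx : x.1 + x.2 = m := Finset.HasAntidiagonal.mem_antidiagonal.mp hx
  have hdeg := congrArg Finsupp.degree hx
  rw [map_add] at hdeg
  rw [hf x.1 (by omega), zero_mul]

end orders

/-! ## Order-1 sections from exact kernel sections -/

/-- **ORDER-1 TRUNCATION.**  An exact kernel section `η` (`Σ_q R_oq η_q = 0` for every row) with
`η(0) = c·γ`, `c ≠ 0`, truncates to an affine field `ξ = affField γ λ` with `Σ_q ξ_q R_oq` free of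
terms of degree `≤ 1`, for every row `o`. -/
theorem section01_of_kernelSection {T : ℕ} (R : Fin T → Fin n × Fin n → MvPolynomial (MatMulVars n) ℂ)
    (γ : Fin n × Fin n → ℂ) (η : Fin n × Fin n → MvPolynomial (MatMulVars n) ℂ) {c : ℂ}
    (hc : c ≠ 0) (hker : ∀ o, ∑ q, R o q * η q = 0) (h0 : ∀ q, eval 0 (η q) = c * γ q) :
    ∃ lam : Fin n × Fin n → MatMulVars n → ℂ,
      ∀ (o : Fin T) (m : MatMulVars n →₀ ℕ), m.degree ≤ 1 →
        coeff m (∑ q, affField γ lam q * R o q) = 0 := by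
  classical
  set lam : Fin n × Fin n → MatMulVars n → ℂ := fun q v => c⁻¹ * coeff (Finsupp.single v 1) (η q)
    with hlam
  set M : Fin n × Fin n → MvPolynomial (MatMulVars n) ℂ := fun q => C c⁻¹ * η q - affField γ lam q
    with hM
  refine ⟨lam, fun o m hm => ?_⟩
  have hsum : (∑ q, affField γ lam q * R o q) = -∑ q, M q * R o q := by
    rw [← sub_eq_zero, sub_neg_eq_add, ← Finset.sum_add_distrib,
      show (∑ q, (affField γ lam q * R o q + M q * R o q)) = ∑ q, C c⁻¹ * (R o q * η q) from
        Finset.sum_congr rfl fun q _ => by simp only [hM]; ring,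
      ← Finset.mul_sum, hker o, mul_zero]
  rw [hsum, coeff_neg, neg_eq_zero, coeff_sum]
  refine Finset.sum_eq_zero fun q _ => coeff_mul_eq_zero_of_degree_le_one (fun m' hm' => ?_) _ hm
  have hη0 : coeff 0 (η q) = c * γ q := by
    rw [← h0 q, MvPolynomial.eval_zero, constantCoeff_eq]
  rcases eq_zero_or_single_of_degree_le_one m' hm' with rfl | ⟨v, rfl⟩
  · simp only [hM, coeff_sub, coeff_C_mul, hη0, coeff_zero_affField]
    field_simp
    ring
  · simp only [hM, coeff_sub, coeff_C_mul, coeff_single_affField, hlam, sub_self]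

/-! ## V0/V1 of a deflated test are the degree-`≤ 1` coefficients of `Σ_q ξ_q r_q(t)` -/

/-- `coeff_{x_v}(ι g) = coeff_{x_v}(g)`. -/
theorem coeff_single_inl_liftAB (v : MatMulVars n) (g : MvPolynomial (MatMulVars n) ℂ) :
    coeff (Finsupp.single (Sum.inl v : GraphVars n) 1) (liftAB n g) = coeff (Finsupp.single v 1) g := by
  have h := coeff_rename_mapDomain (Sum.inl : MatMulVars n → GraphVars n) Sum.inl_injective g
    (Finsupp.single v 1)
  rw [Finsupp.mapDomain_single] at h
  exact h

/-- **V0:** `coeff_0(D_ξ t) = coeff_0(Σ_q ξ_q r_q(t))`. -/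
theorem coeff_zero_derivC_eq (ξ : Fin n × Fin n → MvPolynomial (MatMulVars n) ℂ)
    (t : MvPolynomial (GraphVars n) ℂ) :
    coeff 0 (derivC ξ t) = coeff 0 (∑ q, ξ q * rowPoly t q) := by
  have hw := coeff_zero_eq_zero_of_mem_graphIdeal (sub_liftAB_graphRestrict_mem (derivC ξ t))
  rw [coeff_sub, coeff_zero_liftAB, sub_eq_zero, graphRestrict_derivC] at hw
  exact hw

/-- **V1:** `coeff_{x_v}(D_ξ t) = coeff_{x_v}(Σ_q ξ_q r_q(t))`. -/
theorem coeff_single_inl_derivC_eq (ξ : Fin n × Fin n → MvPolynomial (MatMulVars n) ℂ)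
    (t : MvPolynomial (GraphVars n) ℂ) (v : MatMulVars n) :
    coeff (Finsupp.single (Sum.inl v : GraphVars n) 1) (derivC ξ t) =
      coeff (Finsupp.single v 1) (∑ q, ξ q * rowPoly t q) := by
  have hw := coeff_single_inl_eq_zero_of_mem_graphIdeal
    (sub_liftAB_graphRestrict_mem (derivC ξ t)) v
  rw [coeff_sub, coeff_single_inl_liftAB, sub_eq_zero, graphRestrict_derivC] at hw
  exact hw

/-- **An order-1 section gives V0/V1 for every deflated test.** -/
theorem derivC_V01_of_section01 {T : ℕ} (t : Fin T → MvPolynomial (GraphVars n) ℂ)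
    (ξ : Fin n × Fin n → MvPolynomial (MatMulVars n) ℂ)
    (hsec : ∀ (o : Fin T) (m : MatMulVars n →₀ ℕ), m.degree ≤ 1 →
      coeff m (∑ q, ξ q * rowPoly (t o) q) = 0) :
    (∀ o, coeff 0 (derivC ξ (t o)) = 0) ∧
      ∀ o (v : MatMulVars n), coeff (Finsupp.single (Sum.inl v : GraphVars n) 1) (derivC ξ (t o)) = 0 := by
  refine ⟨fun o => ?_, fun o v => ?_⟩
  · rw [coeff_zero_derivC_eq]
    exact hsec o 0 (by simp)
  · rw [coeff_single_inl_derivC_eq]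
    exact hsec o _ (by simp [Finsupp.degree_single])

/-! ## At a base of maximal row rank every tangent carries a V0/V1 affine field -/

/-- **FIELDS FOR THE ENGINE.**  If the row matrix `(r_q(t_o))` has maximal rank at the origin
(`rank R(y) ≤ rank R(0)` for all `y`) and `R(0)γ = 0`, then `γ` is the value at `0` of a cost-free affine
field `ξ` whose deflated tests satisfy V0 and V1. -/
theorem exists_affField_V01 {T : ℕ} (t : Fin T → MvPolynomial (GraphVars n) ℂ)
    (hmax : ∀ y : MatMulVars n → ℂ,
      (Matrix.of fun o q => eval y (rowPoly (t o) q)).rank ≤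
        (Matrix.of fun o q => eval 0 (rowPoly (t o) q)).rank)
    (γ : Fin n × Fin n → ℂ) (hγ : (Matrix.of fun o q => eval 0 (rowPoly (t o) q)).mulVec γ = 0) :
    ∃ lam : Fin n × Fin n → MatMulVars n → ℂ,
      (∀ q, liftAB n (affField γ lam q) ∈ freeSpan (∅ : Set (MvPolynomial (GraphVars n) ℂ))) ∧
      (∀ q, coeff 0 (affField γ lam q) = γ q) ∧
      (∀ o, coeff 0 (derivC (affField γ lam) (t o)) = 0) ∧
      ∀ o (v : MatMulVars n),
        coeff (Finsupp.single (Sum.inl v : GraphVars n) 1) (derivC (affField γ lam) (t o)) = 0 := by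
  obtain ⟨η, c, hc, hker, h0⟩ := kernelSectionAtMaxRank n T (fun o q => rowPoly (t o) q) hmax γ hγ
  obtain ⟨lam, hsec⟩ := section01_of_kernelSection (fun o q => rowPoly (t o) q) γ η hc hker h0
  have hsec' : ∀ (o : Fin T) (m : MatMulVars n →₀ ℕ), m.degree ≤ 1 →
      coeff m (∑ q, affField γ lam q * rowPoly (t o) q) = 0 := hsec
  obtain ⟨hV0, hV1⟩ := derivC_V01_of_section01 t (affField γ lam) hsec'
  exact ⟨lam, liftAB_affField_mem_freeSpan γ lam, coeff_zero_affField γ lam, hV0, hV1⟩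

end Summit.MatrixMultiplication.MatrixMultiplication.Theorems.GraphEquations

end
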